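import Summits.ResolutionOfSingularities.ResolutionOfSingularities.Theorems.RadicialJungCleanModelsStubCompletionDerivationParam
import Summits.ResolutionOfSingularities.ResolutionOfSingularities.Theorems.RadicialJungCleanModelsStubCompletionLift
import Mathlib.RingTheory.Localization.FractionRing
import Mathlib.Data.Int.GCD
import HarnessLib

/-!
# Stub `stub_toroidalTwist` for crux stmt-ResolutionOfSingularities-15917
(`RadicialJung.CleanModels`)

Generisation of TOROIDAL loose cleanness to a prime `q` containing none of the boundary
parameters. Let `O` be a regular local ring of prime characteristic `p` with fraction field `K`,
`x = u ∏_{i<m} t_i^{a_i}` (`u` a unit, `(t) = 𝔪`, `d = dim O`, `m ≥ 1`, `p ∤ a_i`) and `q` a prime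
of `O` with `t_i ∉ q` for all `i < m`. Then some admissible modification `e^p x^α` (`p ∤ α`,
`e ≠ 0`) is the image of an element `f ∈ O ∖ q` which is detected by a derivation of the
completion `Ô`: `D(f) ∉ Q` for every prime `Q` of `Ô` over `q`.

Proof. Fix a boundary index `i₀` and `α` with `α a_{i₀} ≡ 1 (mod p)`; write
`α a_i = p k_i + r_i` (`r_{i₀} = 1`), `P := ∏ t_i^{k_i}`, `f := u^α ∏ t_i^{r_i}`, so that
`x^α = P^p f` in `O`, `P, f ∉ q`, and `e := P⁻¹`. For `D := ∂/∂t_{i₀}` on `Ô`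
(`stub_completionDerivationParam`) the Leibniz rule gives
`D(f) = W (u^α + t_{i₀} D(u^α))` with `W := ∏_{i ≠ i₀} t_i^{r_i} ∉ Q` and the second factor a
unit of the local ring `Ô` (`u^α` is a unit, `t_{i₀} ∈ 𝔪̂`), whence `D(f) ∉ Q`.
-/

noncomputable section

set_option linter.dupNamespace false

open IsLocalRing

namespace Summit.ResolutionOfSingularities.ResolutionOfSingularities.Theorems.RadicialJung.CleanModels

universe u

/-- A product of powers of elements outside a prime ideal lies outside it. -/
theorem prod_pow_not_mem_of_isPrime {R ι : Type*} [CommSemiring R] {Q : Ideal R}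
    (hQ : Q.IsPrime) (s : Finset ι) (x : ι → R) (n : ι → ℕ) (hx : ∀ i ∈ s, x i ∉ Q) :
    ∏ i ∈ s, x i ^ n i ∉ Q := fun h => by
  obtain ⟨i, hi, hiQ⟩ := (Ideal.IsPrime.prod_mem_iff (hp := hQ)).1 h
  exact hx i hi (hQ.mem_of_pow_mem _ hiQ)

/-- Exponent bookkeeping of the toroidal twist: if `α a_i = p k_i + r_i` for all `i`, then
`(u ∏ t_i^{a_i})^α = (∏ t_i^{k_i})^p · (u^α ∏ t_i^{r_i})`. -/
theorem mul_prod_pow_pow_eq {R ι : Type*} [CommMonoid R] [Fintype ι] (u : R) (t : ι → R)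
    (a k r : ι → ℕ) {α p : ℕ} (h : ∀ i, α * a i = p * k i + r i) :
    (u * ∏ i, t i ^ a i) ^ α = (∏ i, t i ^ k i) ^ p * (u ^ α * ∏ i, t i ^ r i) := by
  have h' : ∀ i, (t i ^ a i) ^ α = (t i ^ k i) ^ p * t i ^ r i := fun i => by
    rw [← pow_mul, mul_comm (a i) α, h, pow_add, pow_mul']
  calc (u * ∏ i, t i ^ a i) ^ α = u ^ α * ∏ i, (t i ^ a i) ^ α := by
        rw [mul_pow, Finset.prod_pow]
    _ = u ^ α * ∏ i, ((t i ^ k i) ^ p * t i ^ r i) := by simp_rw [h']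
    _ = (∏ i, t i ^ k i) ^ p * (u ^ α * ∏ i, t i ^ r i) := by
        rw [Finset.prod_mul_distrib, Finset.prod_pow, mul_left_comm]

/-- The Leibniz computation behind the toroidal twist. In a local ring `A` with a derivation
`D`, let `T : Fin m → A`, `r : Fin m → ℕ` and `i₀` be such that `r i₀ = 1`, `D (T i₀) = 1`,
`D (T i) = 0` for `i ≠ i₀`, and `T i₀ ∈ 𝔪_A`; let `U` be a unit and `Q` a prime containing no
`T i`. Then `D (U^α ∏ T_i^{r_i}) = W (U^α + T_{i₀} D(U^α))` with `W = ∏_{i ≠ i₀} T_i^{r_i} ∉ Q`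
and `U^α + T_{i₀} D(U^α)` a unit, so `D (U^α ∏ T_i^{r_i}) ∉ Q`. -/
theorem derivation_mul_prod_pow_not_mem {A : Type*} [CommRing A] [IsLocalRing A] [Algebra ℤ A]
    (D : Derivation ℤ A A) {m : ℕ} (T : Fin m → A) (r : Fin m → ℕ) (i₀ : Fin m)
    (hr : r i₀ = 1) (hD1 : D (T i₀) = 1) (hD0 : ∀ i, i ≠ i₀ → D (T i) = 0)
    (hT₀ : T i₀ ∈ maximalIdeal A) {U : A} (hU : IsUnit U) (α : ℕ) {Q : Ideal A}
    (hQ : Q.IsPrime) (hTQ : ∀ i, T i ∉ Q) :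
    D (U ^ α * ∏ i, T i ^ r i) ∉ Q := by
  classical
  -- split off the factor `i₀`
  obtain ⟨W, hW⟩ : ∃ W : A, ∏ i ∈ Finset.univ.erase i₀, T i ^ r i = W := ⟨_, rfl⟩
  have hprod : ∏ i, T i ^ r i = T i₀ * W := by
    rw [← Finset.mul_prod_erase Finset.univ (fun i => T i ^ r i) (Finset.mem_univ i₀), hr,
      pow_one, hW]
  -- `D` kills `W`
  have hDW : D W = 0 := by
    rw [← hW]
    refine Finset.prod_induction (s := Finset.univ.erase i₀) (fun i => T i ^ r i)
      (fun x => D x = 0) ?_ ?_ ?_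
    · intro a b ha hb
      simp only [Derivation.leibniz, ha, hb, smul_zero, add_zero]
    · exact D.map_one_eq_zero
    · intro i hi
      show D (T i ^ r i) = 0
      rw [Derivation.leibniz_pow, hD0 i (Finset.ne_of_mem_erase hi), smul_zero, smul_zero]
  have hWQ : W ∉ Q := by
    rw [← hW]
    exact prod_pow_not_mem_of_isPrime hQ _ T r fun i _ => hTQ i
  -- Leibniz
  have hDf : D (U ^ α * ∏ i, T i ^ r i) = W * (U ^ α + T i₀ * D (U ^ α)) := by
    rw [hprod, Derivation.leibniz, Derivation.leibniz, hDW, hD1]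
    simp only [smul_eq_mul, mul_zero, zero_add, mul_one]
    ring
  -- the second factor is a unit of the local ring `A`
  have hunit : IsUnit (U ^ α + T i₀ * D (U ^ α)) := by
    by_contra hV
    have hV' : U ^ α + T i₀ * D (U ^ α) ∈ maximalIdeal A :=
      (mem_maximalIdeal _).2 (mem_nonunits_iff.2 hV)
    have hUα : U ^ α ∈ maximalIdeal A := by
      have h := sub_mem hV' (Ideal.mul_mem_right (D (U ^ α)) _ hT₀)
      rwa [add_sub_cancel_right] at h
    exact mem_nonunits_iff.1 ((mem_maximalIdeal _).1 hUα) (hU.pow α)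
  intro h
  rw [hDf] at h
  rcases hQ.mem_or_mem h with h | h
  · exact hWQ h
  · exact hQ.ne_top (Ideal.eq_top_of_isUnit_mem _ h hunit)

/-- **Toroidal forms with no boundary parameter in `q`: the twist.** Let `O` be a regular local
ring of prime characteristic `p` with fraction field `K`, `x = u ∏_{i<m} t_i^{a_i}` loosely
toroidal (`u` a unit, `(t) = 𝔪`, `d = dim O`, `0 < m`, `p ∤ a_i`), and `q` a prime of `O`
containing none of the boundary parameters `t_i`, `i < m`. Then there are `α` prime to `p`,
`e ∈ K^×` and `f ∈ O ∖ q` with `e^p x^α = f` in `K`, and a derivation `D` of the completion `Ô`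
with `D(f) ∉ Q` for every prime `Q` of `Ô` lying over `q`. (Choose `α a_{i₀} ≡ 1 (mod p)`,
`α a_i = p k_i + r_i`, `e = (∏ t_i^{k_i})⁻¹`, `f = u^α ∏ t_i^{r_i}`, `D = ∂/∂t_{i₀}` from
`stub_completionDerivationParam`; then `D(f) = (∏_{i≠i₀} t_i^{r_i}) · (u^α + t_{i₀} D(u^α))`,
a non-member of `Q` times a unit.) -/
theorem stub_toroidalTwist {O : Type u} [CommRing O] [IsRegularLocalRing O] (p : ℕ)
    [Fact p.Prime] [CharP O p] {K : Type u} [Field K] [Algebra O K] [IsFractionRing O K]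
    {d m : ℕ} (hmd : m ≤ d) (t : Fin d → O) (a : Fin m → ℕ) (u : O) (hu : IsUnit u)
    (ht : Ideal.span (Set.range t) = maximalIdeal O) (hd : ringKrullDim O = d) (hm : 0 < m)
    (ha : ∀ i, ¬ p ∣ a i) (q : Ideal O) [q.IsPrime] (hS : ∀ i : Fin m, t (Fin.castLE hmd i) ∉ q) :
    ∃ (α : ℕ) (e : K) (f : O), α.Coprime p ∧ e ≠ 0 ∧ f ∉ q ∧
      e ^ p * (algebraMap O K (u * ∏ i : Fin m, t (Fin.castLE hmd i) ^ (a i))) ^ α =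
        algebraMap O K f ∧
      ∃ D : Derivation ℤ (AdicCompletion (maximalIdeal O) O) (AdicCompletion (maximalIdeal O) O),
        ∀ Q : Ideal (AdicCompletion (maximalIdeal O) O), Q.IsPrime →
          Q.comap (algebraMap O (AdicCompletion (maximalIdeal O) O)) = q →
          D (algebraMap O (AdicCompletion (maximalIdeal O) O) f) ∉ Q := by
  have hp : p.Prime := Fact.out
  have hq : q.IsPrime := ‹q.IsPrime›
  -- a boundary index `i₀` and an exponent `α` with `α a_{i₀} ≡ 1 (mod p)`
  obtain ⟨i₀⟩ : Nonempty (Fin m) := ⟨⟨0, hm⟩⟩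
  obtain ⟨α, -, hα⟩ := Nat.exists_mul_mod_eq_one_of_coprime
    ((Nat.Prime.coprime_iff_not_dvd hp).2 (ha i₀)).symm hp.one_lt
  have hαp : α.Coprime p := by
    refine ((Nat.Prime.coprime_iff_not_dvd hp).2 fun h => ?_).symm
    rw [Nat.mod_eq_zero_of_dvd (h.mul_left (a i₀))] at hα
    exact zero_ne_one hα
  -- `α a_i = p k_i + r_i` with `r_{i₀} = 1`
  obtain ⟨k, r, hkr, hr₀⟩ : ∃ k r : Fin m → ℕ, (∀ i, α * a i = p * k i + r i) ∧ r i₀ = 1 :=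
    ⟨fun i => α * a i / p, fun i => α * a i % p, fun i => (Nat.div_add_mod _ _).symm, by
      show α * a i₀ % p = 1
      rw [mul_comm]
      exact hα⟩
  -- `P := ∏ t_i^{k_i}`, `f := u^α ∏ t_i^{r_i}`; both avoid `q`
  obtain ⟨P, hP⟩ : ∃ P : O, ∏ i : Fin m, t (Fin.castLE hmd i) ^ k i = P := ⟨_, rfl⟩
  obtain ⟨f, hf⟩ : ∃ f : O, u ^ α * ∏ i : Fin m, t (Fin.castLE hmd i) ^ r i = f := ⟨_, rfl⟩
  have huq : u ∉ q := fun h => hq.ne_top (Ideal.eq_top_of_isUnit_mem _ h hu)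
  have hPq : P ∉ q := hP ▸ prod_pow_not_mem_of_isPrime hq _ _ _ fun i _ => hS i
  have hfq : f ∉ q := by
    rw [← hf]
    intro h
    rcases hq.mem_or_mem h with h | h
    · exact huq (hq.mem_of_pow_mem _ h)
    · exact prod_pow_not_mem_of_isPrime hq _ _ _ (fun i _ => hS i) h
  have hP0 : algebraMap O K P ≠ 0 := fun h =>
    hPq (by rw [(IsFractionRing.to_map_eq_zero_iff (K := K)).1 h]; exact q.zero_mem)
  -- the identity `x^α = P^p f` in `O`
  have hident : (u * ∏ i : Fin m, t (Fin.castLE hmd i) ^ a i) ^ α = P ^ p * f := by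
    rw [← hP, ← hf]
    exact mul_prod_pow_pow_eq u (fun i => t (Fin.castLE hmd i)) a k r hkr
  refine ⟨α, (algebraMap O K P)⁻¹, f, hαp, inv_ne_zero hP0, hfq, ?_, ?_⟩
  · rw [← map_pow, hident, map_mul, map_pow, ← mul_assoc, ← mul_pow, inv_mul_cancel₀ hP0,
      one_pow, one_mul]
  · -- the derivation `∂/∂t_{i₀}` of the completion
    obtain ⟨D, hD1, hD0⟩ := stub_completionDerivationParam p t ht hd (Fin.castLE hmd i₀)
    refine ⟨D, fun Q hQ hQq => ?_⟩
    have hf' : algebraMap O (AdicCompletion (maximalIdeal O) O) f =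
        algebraMap O (AdicCompletion (maximalIdeal O) O) u ^ α *
          ∏ i : Fin m, algebraMap O (AdicCompletion (maximalIdeal O) O)
            (t (Fin.castLE hmd i)) ^ r i := by
      rw [← hf, map_mul, map_pow, map_prod]
      simp only [map_pow]
    rw [hf']
    have ht₀ : t (Fin.castLE hmd i₀) ∈ maximalIdeal O := by
      rw [← ht]
      exact Ideal.subset_span ⟨_, rfl⟩
    refine derivation_mul_prod_pow_not_mem D
      (fun i => algebraMap O (AdicCompletion (maximalIdeal O) O) (t (Fin.castLE hmd i))) r i₀
      hr₀ hD1 (fun i hi => hD0 _ fun h => hi (Fin.castLE_injective hmd h)) ?_ (hu.map _) α hQ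
      (fun i h => hS i (by rw [← hQq, Ideal.mem_comap]; exact h))
    -- `t_{i₀}` stays a non-unit in `Ô` (the completion map is local)
    exact (mem_maximalIdeal _).2 (mem_nonunits_iff.2 fun h =>
      mem_nonunits_iff.1 ((mem_maximalIdeal _).1 ht₀) ((isUnit_map_iff _ _).1 h))

end Summit.ResolutionOfSingularities.ResolutionOfSingularities.Theorems.RadicialJung.CleanModels

end
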